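/-
Copyright (c) 2026 the pub-hodgecm-mathlib formalisation cell (harness21).  Prover seat hodgecm-mathlib-F0P3-p02 (g27), 2026-09-03.  E1 row 68-A GENERIC «EVERY MEMBER IS A SUB —
THE SCHUR PAIR OF A GIVEN EMBEDDING» (E1 keeper ∕ dealer F0P3a-p03 (g31) k24 05:25:00Z; census `CENSUS-R68-K4primeUNR.v1` §3 (F0P3b-p01 (g26)); sibling of ★ row 63
`IrreducibleEmbeddingSchurPair` p853497).
-/
import Literature.NumberTheory.Automorphic.IrreducibleEmbeddingSchurPair   -- ★ row 63 (this seat) p853497: §1 image of an irreducible, §2 Schur pair, §3 (d2a′), §4 the package with the Frobenius step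
import HarnessLib

/-!
# The Schur pair of a GIVEN embedding of an irreducible into a length-two representation (★ row 63 (4) with the Frobenius step replaced by a given `f`)

Topic `NumberTheory/Automorphic`; namespace `Literature.NumberTheory.Automorphic.IrrClass` (sibling of ★ `IrreducibleEmbeddingSchurPair`).  THEOREMS ONLY (no definition, no instance,
no notation, no named fact, no `sorry`).  Cell `pub/hodgecm-mathlib` (D-0151), crux H413 = `stmt-HodgeConjecture-24833`, lane `--supports`; E1 BRICK LEDGER row 68-A GENERIC: ★ row 63 (4)
`exists_realisation_schurPair` REALISES the labelled constituent `πs` of `I₀ = i_P(ℂ_{θ₂})` as a sub through Frobenius reciprocity from `r_P(πs) ≅ ℂ_{θ₂}`; for the K4′ assembly (census R68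
§1 (S1) «EVERY MEMBER IS A SUB») the embedding `f : r ↪ I₀` of EITHER member of an l.d.s. packet is given directly (★ N2 `u3PrincipalSeriesConstituentEmbeds_holds` + `wχ = χ`), so the same
Schur pair is wanted for a GIVEN injective `f`, with no Jacquet datum on the sub side.  This file is that statement; the ambient is generalised from `i_P(ℂ_{θ₂})` to ANY smooth-admissible
`ρ` of length two with constituents `{πn, πs}` (head (1)), and specialised back to ★ (4)'s ambient verbatim (head (2)).  The binder `hδ : δ_P|_N = 1` of (4) is NOT carried: without the
Frobenius step nothing reads it.  HONEST LABEL: count-neutral generic helper; (R-SS) banked PAYDOWN-UNR for K1 only; K4′ = shrink candidate, PRINT of record until LEAD prices the ride;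
HC_CM is proved only modulo the printed citations (hLiu418 = `stmt-HodgeConjecture-24832`, h413 = `stmt-HodgeConjecture-24833`) until rung 0 closes.

THE MATHEMATICS (as ★ row 63: [Casselman1995 §7.1, Cor. 7.1.2]; [BushnellHenniart2006 §1.1]; [Bump1997 Prop. 4.2.4]; [BernsteinZelevinsky1977 §2.3]).  `ρ` smooth admissible without
`3`-chains, constituents exactly `{πn, πs}`, `πs ≠ πn`; `r` a representative of `πs` and `f : r ↪ ρ` an injective intertwiner; `r_P` of some representative of `πn` is `ℂ_{θ₁}` (so
non-zero).  Then `A := f(r)` is `G`-stable with `ρ|_A ≅ r` irreducible of class `πs` (★ 63 §1), `0 ≠ A ≠ V` (★ 63 §2), `ρ∕A` irreducible of class `πn`, `Hom_G(ρ|_A, ρ∕A) = 0`,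
`dim End_G(ρ|_A) = 1` (admissible Schur at a compact open `K`), and `r_P(ρ∕A) ≠ 0` (★ 63 §3).

* (1) **`exists_realisation_schurPair_of_injective`** — any ambient `ρ`.
* (2) **`exists_realisation_schurPair_of_injective_normalizedInd`** — the ambient `I₀ = normalizedInd t (𝟙 ⊗ θ₂)` of ★ (4), conclusion VERBATIM (4)'s.
Consumer: 68-A DATUM `Theorems/F0P3cStCharTSLdsRealisationBoth.lean` (F0P3b-p01 (g26)), then 68-B∕C∕H∕I (census R68 §3).

## References
* [Casselman1995] W. Casselman, *Introduction to the theory of admissible representations of p-adic reductive groups* (1995): §7.1, Cor. 7.1.2, Cor. 6.3.9, Thm 3.2.4.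
* [BernsteinZelevinsky1977] I. N. Bernstein, A. V. Zelevinsky, *Induced representations of reductive p-adic groups I*, Ann. Sci. ÉNS 10 (1977): §2.3.
* [BushnellHenniart2006] C. J. Bushnell, G. Henniart, *The local Langlands conjecture for GL(2)* (2006): §1.1, §2.
* [Bump1997] D. Bump, *Automorphic Forms and Representations* (1997): Proposition 4.2.4.
-/

set_option autoImplicit false

noncomputable section

open Function

namespace Literature.NumberTheory.Automorphic

namespace IrrClass

open _root_.Representation

variable {G : Type} [Group G] [TopologicalSpace G] [IsTopologicalGroup G]

/-- **ROW 68-A GENERIC — THE SCHUR PAIR OF A GIVEN EMBEDDING.**  `ρ` smooth ADMISSIBLE of length two (no `3`-chains) with constituents exactly `{πn, πs}`, `πs ≠ πn`; `r` a representative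
of `πs` with an INJECTIVE intertwiner `f : r ↪ ρ`; some representative of `πn` has `r_P ≅ ℂ_{θ₁}` (`t` a parabolic triple); `K ≤ G` compact open.  THEN there is a `G`-stable `A ≤ ρ`
(namely `f(r)`) with: (`hAirr`) every `G`-stable `B ≤ A` is `0` or `A`; (`hHom0`) `Hom_G(ρ|_A, ρ∕A) = 0`; (`hSchur`) `dim End_G(ρ|_A) = 1`; `⟦ρ|_A⟧ = πs`; `⟦ρ∕A⟧ = πn`; and (d2a′)
`r_P(ρ∕A) ≠ 0` — ★ row 63 (4) with the Frobenius step replaced by the given `f` and the ambient generalised. [cite: Casselman1995, §7.1, Cor. 7.1.2] [cite: BushnellHenniart2006, §1.1]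
[cite: Bump1997, Proposition 4.2.4] [cite: BernsteinZelevinsky1977, §2.3] -/
theorem exists_realisation_schurPair_of_injective {V : Type} [AddCommGroup V] [Module ℂ V] (t : ParabolicTriple G) [LocallyCompactSpace t.P] {θ₁ : ↥t.M →* ℂˣ}
    {ρ : Representation ℂ G V} (hadm : ρ.IsAdmissible) {K : Subgroup G} (hKo : IsOpen (K : Set G)) (hKc : IsCompact (K : Set G))
    (hlen : ∀ N₁ N₂ : Subrepresentation ρ, ¬ (⊥ < N₁ ∧ N₁ < N₂ ∧ N₂ < ⊤))
    {πs πn : IrrClass G} (hne : πs ≠ πn) (hJH : ∀ c : IrrClass G, c.IsConstituentOf ρ ↔ (c = πn ∨ c = πs))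
    (r : SmoothIrrep G) (hr : IrrClass.mk r = πs) (f : r.ρ.IntertwiningMap ρ) (hf : Injective f)
    (hn : ∃ r' : SmoothIrrep G, IrrClass.mk r' = πn ∧ Nonempty ((r'.ρ.normalizedJacquet t).Equiv ((Representation.trivial ℂ ↥t.M ℂ).twist θ₁))) :
    ∃ (A : Submodule ℂ V) (hAinv : ∀ g, A ≤ A.comap (ρ g)),
      (∀ B : Submodule ℂ V, B ≤ A → (∀ g, B ≤ B.comap (ρ g)) → B = ⊥ ∨ B = A) ∧
      (∀ ψ : IntertwiningMap (ρ.subrepresentation A hAinv) (ρ.quotient A hAinv), ψ = 0) ∧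
      Module.finrank ℂ (IntertwiningMap (ρ.subrepresentation A hAinv) (ρ.subrepresentation A hAinv)) = 1 ∧
      (∃ (hirr : (ρ.subrepresentation A hAinv).IsIrreducible) (hsm : (ρ.subrepresentation A hAinv).IsSmooth), IrrClass.mk (SmoothIrrep.mk ↥A _ hirr hsm) = πs) ∧
      (∃ (hirr : (ρ.quotient A hAinv).IsIrreducible) (hsm : (ρ.quotient A hAinv).IsSmooth), IrrClass.mk (SmoothIrrep.mk (V ⧸ A) _ hirr hsm) = πn) ∧
      Nontrivial (t.restrict (ρ.quotient A hAinv)).Coinvariants := by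
  have hρ : ρ.IsSmooth := hadm.isSmooth
  haveI : r.ρ.IsIrreducible := r.isIrreducible
  set A : Submodule ℂ V := LinearMap.range f.toLinearMap with hA
  have hAinv : ∀ g, A ≤ A.comap (ρ g) := range_le_comap_of_intertwiningMap f
  let N : Subrepresentation ρ := ⟨A, fun g _ hv => hAinv g hv⟩
  -- the sub is irreducible smooth of class `πs`
  have hirrA : (ρ.subrepresentation A hAinv).IsIrreducible := isIrreducible_subrepresentation_range f hf
  have hsmA : (ρ.subrepresentation A hAinv).IsSmooth := hρ.toRepresentation N
  obtain ⟨eA⟩ := nonempty_equiv_subrepresentation_range f hf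
  have hclsA : IrrClass.mk (SmoothIrrep.mk ↥A (ρ.subrepresentation A hAinv) hirrA hsmA) = πs := by
    rw [← hr]
    exact (IrrClass.mk_eq_mk_of_equiv (r₁ := r) (r₂ := SmoothIrrep.mk ↥A (ρ.subrepresentation A hAinv) hirrA hsmA) eA).symm
  -- the quotient is irreducible smooth of class `πn`
  have hb : A ≠ ⊥ := range_ne_bot_of_injective f hf
  have ht : A ≠ ⊤ := range_ne_top_of_constituents_pair hJH hne.symm f hf
  have hirrQ : (ρ.quotient A hAinv).IsIrreducible := isIrreducible_quotient_of_forall_not_lt_lt hlen A hAinv hb ht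
  have hsmQ : (ρ.quotient A hAinv).IsSmooth := hρ.quotientRep N
  have hJH' : ∀ c : IrrClass G, c.IsConstituentOf ρ ↔ (c = πs ∨ c = πn) := fun c => (hJH c).trans Or.comm
  have hclsQ : IrrClass.mk (SmoothIrrep.mk (V ⧸ A) (ρ.quotient A hAinv) hirrQ hsmQ) = πn :=
    mk_quotient_eq_of_mk_subrepresentation_eq hρ hJH' hne A hAinv hirrA hsmA hirrQ hsmQ hclsA
  refine ⟨A, hAinv, fun B hB hBinv => forall_le_range_eq_bot_or_eq f B hB hBinv, fun ψ => ?_, ?_, ⟨hirrA, hsmA, hclsA⟩, ⟨hirrQ, hsmQ, hclsQ⟩, ?_⟩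
  · exact intertwiningMap_subrepresentation_quotient_eq_zero A hAinv hirrA hsmA hirrQ hsmQ (by rw [hclsA, hclsQ]; exact hne) ψ
  · exact finrank_intertwiningMap_subrepresentation_self_eq_one hadm hKo hKc A hAinv hirrA
  · exact nontrivial_coinvariants_quotient_of_mk_eq t A hAinv hirrQ hsmQ hclsQ hn

/-- **ROW 68-A GENERIC at ★ (4)'s ambient**: the same for `ρ := I₀ = normalizedInd t (𝟙 ⊗ θ₂)` — ★ row 63 (4) `exists_realisation_schurPair`'s conclusion VERBATIM, its hypothesis
`hs : r_P(πs) ≅ ℂ_{θ₂}` (and `hδ`) replaced by a representative `r` of `πs` with a given injective `f : r ↪ I₀` (census R68 §3's binder list). [cite: Casselman1995, §7.1, Cor. 7.1.2]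
[cite: BushnellHenniart2006, §1.1] [cite: Bump1997, Proposition 4.2.4] -/
theorem exists_realisation_schurPair_of_injective_normalizedInd (t : ParabolicTriple G) [LocallyCompactSpace t.P] {θ₁ θ₂ : ↥t.M →* ℂˣ}
    (hadm : (normalizedInd t ((Representation.trivial ℂ ↥t.M ℂ).twist θ₂)).IsAdmissible) {K : Subgroup G} (hKo : IsOpen (K : Set G)) (hKc : IsCompact (K : Set G))
    (hlen : ∀ N₁ N₂ : Subrepresentation (normalizedInd t ((Representation.trivial ℂ ↥t.M ℂ).twist θ₂)), ¬ (⊥ < N₁ ∧ N₁ < N₂ ∧ N₂ < ⊤))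
    {πs πn : IrrClass G} (hne : πs ≠ πn)
    (hJH : ∀ c : IrrClass G, c.IsConstituentOf (normalizedInd t ((Representation.trivial ℂ ↥t.M ℂ).twist θ₂)) ↔ (c = πn ∨ c = πs))
    (r : SmoothIrrep G) (hr : IrrClass.mk r = πs) (f : r.ρ.IntertwiningMap (normalizedInd t ((Representation.trivial ℂ ↥t.M ℂ).twist θ₂))) (hf : Injective f)
    (hn : ∃ r' : SmoothIrrep G, IrrClass.mk r' = πn ∧ Nonempty ((r'.ρ.normalizedJacquet t).Equiv ((Representation.trivial ℂ ↥t.M ℂ).twist θ₁))) :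
    ∃ (A : Submodule ℂ (SmoothInd t.P (Representation.twist (((Representation.trivial ℂ ↥t.M ℂ).twist θ₂).comp t.proj) (rootDeltaChar t.P))))
      (hAinv : ∀ g, A ≤ A.comap (normalizedInd t ((Representation.trivial ℂ ↥t.M ℂ).twist θ₂) g)),
      (∀ B : Submodule ℂ _, B ≤ A → (∀ g, B ≤ B.comap (normalizedInd t ((Representation.trivial ℂ ↥t.M ℂ).twist θ₂) g)) → B = ⊥ ∨ B = A) ∧
      (∀ ψ : IntertwiningMap ((normalizedInd t ((Representation.trivial ℂ ↥t.M ℂ).twist θ₂)).subrepresentation A hAinv)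
        ((normalizedInd t ((Representation.trivial ℂ ↥t.M ℂ).twist θ₂)).quotient A hAinv), ψ = 0) ∧
      Module.finrank ℂ (IntertwiningMap ((normalizedInd t ((Representation.trivial ℂ ↥t.M ℂ).twist θ₂)).subrepresentation A hAinv)
        ((normalizedInd t ((Representation.trivial ℂ ↥t.M ℂ).twist θ₂)).subrepresentation A hAinv)) = 1 ∧
      (∃ (hirr : ((normalizedInd t ((Representation.trivial ℂ ↥t.M ℂ).twist θ₂)).subrepresentation A hAinv).IsIrreducible)
          (hsm : ((normalizedInd t ((Representation.trivial ℂ ↥t.M ℂ).twist θ₂)).subrepresentation A hAinv).IsSmooth),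
        IrrClass.mk (SmoothIrrep.mk ↥A _ hirr hsm) = πs) ∧
      (∃ (hirr : ((normalizedInd t ((Representation.trivial ℂ ↥t.M ℂ).twist θ₂)).quotient A hAinv).IsIrreducible)
          (hsm : ((normalizedInd t ((Representation.trivial ℂ ↥t.M ℂ).twist θ₂)).quotient A hAinv).IsSmooth),
        IrrClass.mk (SmoothIrrep.mk (_ ⧸ A) _ hirr hsm) = πn) ∧
      Nontrivial (t.restrict ((normalizedInd t ((Representation.trivial ℂ ↥t.M ℂ).twist θ₂)).quotient A hAinv)).Coinvariants :=
  exists_realisation_schurPair_of_injective t hadm hKo hKc hlen hne hJH r hr f hf hn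

end IrrClass

end Literature.NumberTheory.Automorphic

end
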